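import Literature.AlgebraicGeometry.Resolution.FiniteOverCompleteLocal
import Literature.AlgebraicGeometry.Resolution.CompleteLocalDomainNormalizationPowerSeries
import Mathlib
import HarnessLib

/-!
# CM Manin period III — subalgebras of `O^ι` over a complete Noetherian local ring `O` are Henselian at the coordinatewise-`𝔪` ideal
# (the topological input of stub P4 `inertRigidity` of the line card `cm-manin-period`; seed crux `SignedMuSeedAtTwoPlus`
# stmt-BirchSwinnertonDyer-21438, parent Kμ⁺ stmt-BirchSwinnertonDyer-20689, route ResidualThetaTransportAtTwo)

Cell `bsd-wall`, width seat `bsd-wall-rtt-p4-w2` g16 (`--supports`, closes nothing).  THEOREMS ONLY; BSD is not proved by this.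

`…CMManinPeriodRigidity.lean` shows: if a subring `S ⊆ (ι → O)` is Henselian at an ideal `J` whose elements have coordinates in `𝔪_O`, then the
indicator of `{i | t i ≡ 1}` lies in `S` for every `t ∈ S` with `t² − t ∈ J`.  This file discharges the Henselian hypothesis in the situation of
the card (Galois algebra `O_L[ρ_B(G_K)] ⊆ ∏_τ O_L`, `O_L` a complete DVR): for `O` Noetherian local and `𝔪_O`-adically complete, `ι` finite and
ANY `O`-subalgebra `S ⊆ (ι → O)`, the pair `(S, J)` with `J = S ∩ 𝔪_O^ι` (the comap of `Ideal.pi`) is Henselian.  Route: `S` is module-finite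
(`O` Noetherian), hence `𝔪S`-adically complete (`Literature…isAdicComplete_map_of_finite`, Matsumura 8.7); by Artin–Rees
(`Ideal.exists_pow_inf_eq_pow_smul`) `J^e ≤ 𝔪S ≤ J`, so `S` is `J`-adically complete (`Literature…isAdicComplete_of_pow_le_of_le`), hence
Henselian (Mathlib `IsAdicComplete.henselianRing`).

* `mem_coordIdeal_iff`, `coordIdeal_apply_mem` — membership in `J = comap S.val (Ideal.pi 𝔪)` is coordinatewise;
* `map_maximalIdeal_le_coordIdeal` — `𝔪S ≤ J`;
* `pi_pow_le_pi_pow`, `mem_smul_top_of_forall_mem` — `(Ideal.pi 𝔪)^n ≤ Ideal.pi (𝔪^n)`, and a vector with coordinates in `𝔪^n` lies in `𝔪^n • ⊤`;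
* **`exists_coordIdeal_pow_le_map`** — Artin–Rees: `∃ e, J^e ≤ 𝔪S`;
* **`isAdicComplete_coordIdeal`**, **`henselianRing_coordIdeal`** — `S` is `J`-adically complete and `(S, J)` is Henselian.

[folklore]
-/

set_option autoImplicit false
-- the Theorems namespace of this sub repeats the summit name by design (D-0017 nested layout)
set_option linter.dupNamespace false

universe u

namespace Summit.BirchSwinnertonDyer.BirchSwinnertonDyer.Theorems.SignedMuAtTwo.CMManinPeriod

open IsLocalRing

section CoordIdeal

variable {O : Type u} [CommRing O] [IsLocalRing O] {ι : Type u} (S : Subalgebra O (ι → O))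

/-- Membership in the coordinatewise-`𝔪` ideal `J = S ∩ 𝔪^ι` (as `Ideal.comap S.val (Ideal.pi 𝔪)`). [folklore] -/
theorem mem_coordIdeal_iff (s : S) :
    s ∈ Ideal.comap S.val (Ideal.pi fun _ : ι => maximalIdeal O) ↔ ∀ i, (s : ι → O) i ∈ maximalIdeal O := by
  rw [Ideal.mem_comap, Ideal.mem_pi]
  rfl

/-- Elements of the coordinatewise-`𝔪` ideal have coordinates in `𝔪` (hypothesis `hJ` of `exists_separating_idempotent`). [folklore] -/
theorem coordIdeal_apply_mem (s : S) (hs : s ∈ Ideal.comap S.val (Ideal.pi fun _ : ι => maximalIdeal O)) (i : ι) :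
    (s : ι → O) i ∈ maximalIdeal O :=
  (mem_coordIdeal_iff S s).mp hs i

/-- `𝔪S ≤ J`: the extension of `𝔪_O` to `S` has coordinates in `𝔪_O`. [folklore] -/
theorem map_maximalIdeal_le_coordIdeal :
    (maximalIdeal O).map (algebraMap O S) ≤ Ideal.comap S.val (Ideal.pi fun _ : ι => maximalIdeal O) := by
  rw [Ideal.map_le_iff_le_comap]
  intro m hm
  rw [Ideal.mem_comap, mem_coordIdeal_iff]
  intro i
  have h : ((algebraMap O S m : S) : ι → O) = algebraMap O (ι → O) m := rfl
  rw [h, Pi.algebraMap_apply, Algebra.algebraMap_self, RingHom.id_apply]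
  exact hm

end CoordIdeal

section PiLemmas

variable {O : Type u} [CommRing O] {ι : Type u}

/-- Powers of a product ideal: `(Ideal.pi I)^n ≤ Ideal.pi (I^n)`. [folklore] -/
theorem pi_pow_le_pi_pow (I : Ideal O) (n : ℕ) :
    (Ideal.pi fun _ : ι => I) ^ n ≤ Ideal.pi fun _ : ι => I ^ n := by
  induction n with
  | zero =>
    rw [pow_zero, pow_zero, Ideal.one_eq_top, Ideal.one_eq_top]
    intro x _
    rw [Ideal.mem_pi]
    exact fun _ => Submodule.mem_top
  | succ n ih =>
    rw [pow_succ, pow_succ]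
    calc (Ideal.pi fun _ : ι => I) ^ n * Ideal.pi (fun _ : ι => I)
        ≤ Ideal.pi (fun _ : ι => I ^ n) * Ideal.pi (fun _ : ι => I) := Ideal.mul_mono_left ih
      _ ≤ Ideal.pi fun _ : ι => I ^ n * I := by
          rw [Ideal.mul_le]
          intro a ha b hb
          rw [Ideal.mem_pi] at ha hb ⊢
          intro i
          rw [Pi.mul_apply]
          exact Ideal.mul_mem_mul (ha i) (hb i)

/-- A vector with all coordinates in an ideal `I` lies in `I • ⊤ ⊆ (ι → O)` (finite `ι`). [folklore] -/
theorem mem_smul_top_of_forall_mem [Fintype ι] [DecidableEq ι] (I : Ideal O) (f : ι → O) (hf : ∀ i, f i ∈ I) :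
    f ∈ (I • ⊤ : Submodule O (ι → O)) := by
  have hsum : f = ∑ i, f i • (Pi.single i (1 : O) : ι → O) := by
    ext j
    simp [Finset.sum_apply, Pi.single_apply]
  rw [hsum]
  exact Submodule.sum_mem _ fun i _ => Submodule.smul_mem_smul (hf i) Submodule.mem_top

end PiLemmas

section Henselian

variable {O : Type u} [CommRing O] [IsNoetherianRing O] [IsLocalRing O] {ι : Type u} [Fintype ι]
  (S : Subalgebra O (ι → O))

omit [IsLocalRing O] in
/-- An `O`-subalgebra of `ι → O` is module-finite (`O` Noetherian, `ι` finite). [folklore] -/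
theorem moduleFinite_subalgebra_pi : Module.Finite O S :=
  Module.Finite.of_injective S.val.toLinearMap Subtype.val_injective

/-- **Artin–Rees for the coordinate ideal**: `J^e ≤ 𝔪S` for some `e`, where `J = S ∩ 𝔪^ι`. [folklore] -/
theorem exists_coordIdeal_pow_le_map :
    ∃ e : ℕ, (Ideal.comap S.val (Ideal.pi fun _ : ι => maximalIdeal O)) ^ e
      ≤ (maximalIdeal O).map (algebraMap O S) := by
  classical
  obtain ⟨k, hk⟩ := Ideal.exists_pow_inf_eq_pow_smul (maximalIdeal O) (M := ι → O) (Subalgebra.toSubmodule S)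
  refine ⟨k + 1, ?_⟩
  intro s hs
  -- coordinates of `s` lie in `𝔪^(k+1)`
  have hcoord : (s : ι → O) ∈ Ideal.pi fun _ : ι => maximalIdeal O ^ (k + 1) := by
    have h1 := Ideal.le_comap_pow S.val (K := Ideal.pi fun _ : ι => maximalIdeal O) (k + 1) hs
    rw [Ideal.mem_comap] at h1
    exact pi_pow_le_pi_pow (maximalIdeal O) (k + 1) h1
  -- hence `s ∈ 𝔪^(k+1) • ⊤ ⊓ S = 𝔪 • (𝔪^k • ⊤ ⊓ S) ≤ 𝔪 • S` inside `ι → O`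
  have hmem : (s : ι → O) ∈ (maximalIdeal O ^ (k + 1) • ⊤ : Submodule O (ι → O)) ⊓ Subalgebra.toSubmodule S :=
    ⟨mem_smul_top_of_forall_mem _ _ ((Ideal.mem_pi _ _).mp hcoord), s.prop⟩
  rw [hk (k + 1) (Nat.le_succ k), Nat.add_sub_cancel_left, pow_one] at hmem
  have hmem' : (s : ι → O) ∈ (maximalIdeal O • Subalgebra.toSubmodule S : Submodule O (ι → O)) :=
    Submodule.smul_mono le_rfl inf_le_right hmem
  -- transport along the injection `S.val`: `𝔪 • S.toSubmodule = map S.val (𝔪 • ⊤)`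
  have hmap : (maximalIdeal O • Subalgebra.toSubmodule S : Submodule O (ι → O))
      = Submodule.map S.val.toLinearMap (maximalIdeal O • ⊤ : Submodule O S) := by
    rw [Submodule.map_smul'', Submodule.map_top]
    congr 1
    ext x
    constructor
    · intro hx
      exact ⟨⟨x, hx⟩, rfl⟩
    · rintro ⟨y, rfl⟩
      exact y.prop
  rw [hmap, Submodule.mem_map] at hmem'
  obtain ⟨y, hy, hyx⟩ := hmem'
  have hys : y = s := Subtype.val_injective hyx
  rw [← hys]
  -- `𝔪 • ⊤ = 𝔪S` as submodules of `S`
  have htop : (maximalIdeal O • ⊤ : Submodule O S)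
      = ((maximalIdeal O).map (algebraMap O S)).restrictScalars O := Ideal.smul_top_eq_map (maximalIdeal O)
  rw [htop] at hy
  exact hy

variable [IsAdicComplete (maximalIdeal O) O]

/-- **`S` is complete for the coordinate ideal**: an `O`-subalgebra `S ⊆ (ι → O)` over a complete Noetherian local `O` is `J`-adically complete,
`J = S ∩ 𝔪^ι`. [folklore] -/
theorem isAdicComplete_coordIdeal :
    IsAdicComplete (Ideal.comap S.val (Ideal.pi fun _ : ι => maximalIdeal O)) S := by
  haveI : Module.Finite O S := moduleFinite_subalgebra_pi S
  haveI : IsAdicComplete ((maximalIdeal O).map (algebraMap O S)) S :=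
    Literature.AlgebraicGeometry.Resolution.isAdicComplete_map_of_finite O S (maximalIdeal O)
  obtain ⟨e, he⟩ := exists_coordIdeal_pow_le_map S
  exact Literature.AlgebraicGeometry.Resolution.isAdicComplete_of_pow_le_of_le he (map_maximalIdeal_le_coordIdeal S)

/-- **`(S, S ∩ 𝔪^ι)` is a Henselian pair** — the hypothesis `[HenselianRing S J]` of `exists_separating_idempotent` /
`indicator_mem_of_henselian` in the card's situation. [folklore] -/
theorem henselianRing_coordIdeal :
    HenselianRing S (Ideal.comap S.val (Ideal.pi fun _ : ι => maximalIdeal O)) := by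
  haveI := isAdicComplete_coordIdeal S
  infer_instance

end Henselian

end Summit.BirchSwinnertonDyer.BirchSwinnertonDyer.Theorems.SignedMuAtTwo.CMManinPeriod
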